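import Summits.BirchSwinnertonDyer.BirchSwinnertonDyer.Theorems.ManinLocalTwoThreePrimeShiftDescentEngine
import Summits.BirchSwinnertonDyer.BirchSwinnertonDyer.Theorems.ManinLocalTwoThreePrimeShiftHeisenbergLift
import HarnessLib

/-!
# The subgroup `G₁ = Γ₀(pn) ∩ Γ₁(p)`, its two coordinates `β = b`, `λ = c/(pn)` mod `p`, and Heisenberg bookkeeping
# (route `ManinLocalTwoThree`, cell bsd-f2-manin; depth-`p³` step of the prime-generic tower for the LEAD's law
# `ShiftEqualiser.PrimeShiftInvariantIsDiamond`, T-p1-g11-2; prover seat p3 gen 11)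

At `p ≥ 5` the `b`- and `c`-coordinates of the shift descent are NOT additive on `Γ₀(pn)` (the Borel of `SL₂(𝔽_p)` has
`U ⊆ [B, B]`), only on **`G₁ = {γ ∈ Γ₀(pn) : a_γ ≡ 1 (mod p)}`** (`subG1`; index `p − 1`; contains `A⁺`, `T`, `Q₁` and the
parabolics).  This file: `subG1` and its entry lemmas; `betaF = b mod p` and `lamF = c/(pn) mod p` are additive on `G₁`
(`betaF_mul`, `lamF_mul`), `β` vanishes on `A₀ = {p ∣ b}`, `λ` on `B = Γ₀(p²n)`, `β(T) = 1`, `λ(Q₁) = −1`, `λ(T^k) = 0`; and for a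
Heisenberg function `μ(xy) = μx + μy + βx·λy`: `2μ(x^k) = 2kμ(x) + k(k−1)β(x)λ(x)` (`heis_pow`), so `μ` kills `p`-th powers in
`ℤ/p`, `p` odd (`heis_pow_p_eq_zero`).  Consumed by the sibling `…PrimeShiftHeisenbergStep.lean`.
HONEST FRAMING: group theory only; nothing about BSD, Manin's conjecture, C2/C3 or the LEAD's law is asserted.
Reference: HOME/MEMO-es.md §37.13 [cite: DarmonDiamondTaylor1995, Lemma 4.28 (p. 135)].
-/

set_option autoImplicit false
set_option linter.dupNamespace false

noncomputable section

open scoped MatrixGroups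

open CongruenceSubgroup Matrix.SpecialLinearGroup
open Summit.BirchSwinnertonDyer.Rank1Residual.ManinAdditive.NineShiftEqualiser (slOf g0Of g0Of_congr)
open Summit.BirchSwinnertonDyer.Rank1Residual.ManinAdditive.ShiftEqualiser (IsAdd IsShiftInvariant IsDiamond RestrictsFrom
  ShiftInvariantIsDiamondAt PrimeShiftInvariantIsDiamond PrimeShiftInvariantIsDiamondAtPrime)
open Summit.BirchSwinnertonDyer.BirchSwinnertonDyer.Theorems.ManinLocalTwoThree.ThreeShiftDescent (g0Of_mul det_mul_entries
  Tpow Tpow_mul_Tpow Tpow_zero Tpow_inv g0Of_mul_Tpow Tpow_one_mul_mul_Tpow_neg_one addOn_map_one addOn_map_inv addOn_map_zpow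
  conj_invariant_of_generator glue)

namespace Summit.BirchSwinnertonDyer.BirchSwinnertonDyer.Theorems.ManinLocalTwoThree

namespace PrimeShift

/-! ### §1. The subgroup `G₁ = {a ≡ 1 (mod p)}` of `Γ₀(pn)` and its two coordinates `β = b`, `λ = c/(pn)` mod `p` -/

section GOne

variable (p n : ℕ)

/-- `p ∣ a − 1 ⟹ p ∣ d − 1` in `Γ₀(pn)` (`ad ≡ 1` because `p ∣ c`). [folklore] -/
theorem dvd_d_sub_one' {γ : Gamma0 (p * n)} (ha : (p : ℤ) ∣ ((γ : SL(2, ℤ)) 0 0 : ℤ) - 1) :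
    (p : ℤ) ∣ ((γ : SL(2, ℤ)) 1 1 : ℤ) - 1 := by
  have e : ((γ : SL(2, ℤ)) 1 1 : ℤ) - 1 = -((((γ : SL(2, ℤ)) 0 0 : ℤ) - 1) * (γ : SL(2, ℤ)) 1 1) +
      ((γ : SL(2, ℤ)) 0 1 : ℤ) * (γ : SL(2, ℤ)) 1 0 +
      ((((γ : SL(2, ℤ)) 0 0 : ℤ) * (γ : SL(2, ℤ)) 1 1 - ((γ : SL(2, ℤ)) 0 1 : ℤ) * (γ : SL(2, ℤ)) 1 0) - 1) := by ring
  rw [e, gamma0_det_entries γ, sub_self, add_zero]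
  exact dvd_add (Dvd.dvd.mul_right ha _).neg_right (Dvd.dvd.mul_left (p_dvd_c p n γ) _)

/-- **`G₁ = {γ ∈ Γ₀(pn) : a_γ ≡ 1 (mod p)}`** (`= Γ₀(pn) ∩ Γ₁(p)`; index `p − 1`; contains `A⁺`, `T`, `Q₁`). [folklore] -/
def subG1 : Subgroup (Gamma0 (p * n)) where
  carrier := {γ | (p : ℤ) ∣ ((γ : SL(2, ℤ)) 0 0 : ℤ) - 1}
  mul_mem' := by
    intro x y hx hy
    simp only [Set.mem_setOf_eq] at hx hy ⊢
    have e0 : (((x * y : Gamma0 (p * n)) : SL(2, ℤ)) 0 0 : ℤ) - 1 =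
        (((x : SL(2, ℤ)) 0 0 : ℤ) - 1) * (y : SL(2, ℤ)) 0 0 + (((y : SL(2, ℤ)) 0 0 : ℤ) - 1) +
          (x : SL(2, ℤ)) 0 1 * (y : SL(2, ℤ)) 1 0 := by
      simp [Matrix.mul_apply, Fin.sum_univ_two]; ring
    rw [e0]
    exact dvd_add (dvd_add (Dvd.dvd.mul_right hx _) hy) (Dvd.dvd.mul_left (p_dvd_c p n y) _)
  one_mem' := by simp
  inv_mem' := by
    intro x hx
    simp only [Set.mem_setOf_eq] at hx ⊢
    have e0 : (((x⁻¹ : Gamma0 (p * n)) : SL(2, ℤ)) 0 0 : ℤ) = (x : SL(2, ℤ)) 1 1 := by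
      simp [Matrix.SpecialLinearGroup.coe_inv, Matrix.adjugate_fin_two]
    rw [e0]
    exact dvd_d_sub_one' p n hx

/-- Membership in `G₁`. [folklore] -/
theorem mem_subG1 {γ : Gamma0 (p * n)} : γ ∈ subG1 p n ↔ (p : ℤ) ∣ ((γ : SL(2, ℤ)) 0 0 : ℤ) - 1 := Iff.rfl

/-- `A⁺ ≤ G₁`. [folklore] -/
theorem subA_le_subG1 : subA p n ≤ subG1 p n := fun _ hx => hx.2

/-- The `b`-coordinate `β(γ) = b_γ mod p`. [folklore] -/
def betaF (γ : Gamma0 (p * n)) : ZMod p := (((γ : SL(2, ℤ)) 0 1 : ℤ) : ZMod p)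

/-- The `c`-coordinate `λ(γ) = c_γ/(pn) mod p`. [folklore] -/
def lamF (γ : Gamma0 (p * n)) : ZMod p := ((((γ : SL(2, ℤ)) 1 0 : ℤ) / ((p * n : ℕ) : ℤ) : ℤ) : ZMod p)

variable {p n}

/-- casting a multiple of `p` to `ℤ/p` gives `0`. [folklore] -/
theorem zmod_eq_zero_of_dvd {x : ℤ} (h : (p : ℤ) ∣ x) : ((x : ℤ) : ZMod p) = 0 :=
  (ZMod.intCast_zmod_eq_zero_iff_dvd x p).mpr h

/-- **`β` is additive on `G₁`** (`(γδ)_b = a_γ b_δ + b_γ d_δ ≡ b_δ + b_γ`). [folklore] -/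
theorem betaF_mul : ∀ x ∈ subG1 p n, ∀ y ∈ subG1 p n, betaF p n (x * y) = betaF p n x + betaF p n y := by
  intro x hx y hy
  have hyd := dvd_d_sub_one' p n hy
  unfold betaF
  have e : (((x * y : Gamma0 (p * n)) : SL(2, ℤ)) 0 1 : ℤ) = (x : SL(2, ℤ)) 0 1 + (y : SL(2, ℤ)) 0 1 +
      ((((x : SL(2, ℤ)) 0 0 : ℤ) - 1) * (y : SL(2, ℤ)) 0 1 + (x : SL(2, ℤ)) 0 1 * (((y : SL(2, ℤ)) 1 1 : ℤ) - 1)) := by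
    simp [Matrix.mul_apply, Fin.sum_univ_two]; ring
  rw [e, ← Int.cast_add, ZMod.intCast_eq_intCast_iff_dvd_sub]
  rw [show ((x : SL(2, ℤ)) 0 1 : ℤ) + (y : SL(2, ℤ)) 0 1 - ((x : SL(2, ℤ)) 0 1 + (y : SL(2, ℤ)) 0 1 +
      ((((x : SL(2, ℤ)) 0 0 : ℤ) - 1) * (y : SL(2, ℤ)) 0 1 + (x : SL(2, ℤ)) 0 1 * (((y : SL(2, ℤ)) 1 1 : ℤ) - 1))) =
      -((((x : SL(2, ℤ)) 0 0 : ℤ) - 1) * (y : SL(2, ℤ)) 0 1 + (x : SL(2, ℤ)) 0 1 * (((y : SL(2, ℤ)) 1 1 : ℤ) - 1)) by ring]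
  exact (dvd_add (Dvd.dvd.mul_right hx _) (Dvd.dvd.mul_left hyd _)).neg_right

/-- `pn ∣ c` for every element of `Γ₀(pn)`. [folklore] -/
theorem pn_dvd_c (γ : Gamma0 (p * n)) : ((p * n : ℕ) : ℤ) ∣ ((γ : SL(2, ℤ)) 1 0 : ℤ) :=
  (ZMod.intCast_zmod_eq_zero_iff_dvd _ _).mp (Gamma0_mem.mp γ.2)

/-- **`λ` is additive on `G₁`** (`(γδ)_c/(pn) = c₀ a_δ + d_γ c₀′ ≡ c₀ + c₀′`). [folklore] -/
theorem lamF_mul [NeZero p] [NeZero n] :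
    ∀ x ∈ subG1 p n, ∀ y ∈ subG1 p n, lamF p n (x * y) = lamF p n x + lamF p n y := by
  intro x hx y hy
  have hxd := dvd_d_sub_one' p n hx
  have hpn : ((p * n : ℕ) : ℤ) ≠ 0 := by exact_mod_cast (NeZero.ne (p * n))
  obtain ⟨c₀, hc₀⟩ := pn_dvd_c x
  obtain ⟨c₀', hc₀'⟩ := pn_dvd_c y
  unfold lamF
  have e : (((x * y : Gamma0 (p * n)) : SL(2, ℤ)) 1 0 : ℤ) =
      ((p * n : ℕ) : ℤ) * (c₀ * (y : SL(2, ℤ)) 0 0 + (x : SL(2, ℤ)) 1 1 * c₀') := by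
    have : (((x * y : Gamma0 (p * n)) : SL(2, ℤ)) 1 0 : ℤ) = (x : SL(2, ℤ)) 1 0 * (y : SL(2, ℤ)) 0 0 + (x : SL(2, ℤ)) 1 1 * (y : SL(2, ℤ)) 1 0 := by
      simp [Matrix.mul_apply, Fin.sum_univ_two]
    rw [this, hc₀, hc₀']; ring
  rw [e, hc₀, hc₀', Int.mul_ediv_cancel_left _ hpn, Int.mul_ediv_cancel_left _ hpn, Int.mul_ediv_cancel_left _ hpn,
    ← Int.cast_add, ZMod.intCast_eq_intCast_iff_dvd_sub,
    show c₀ + c₀' - (c₀ * ((y : SL(2, ℤ)) 0 0 : ℤ) + (x : SL(2, ℤ)) 1 1 * c₀') =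
      -(c₀ * (((y : SL(2, ℤ)) 0 0 : ℤ) - 1) + (((x : SL(2, ℤ)) 1 1 : ℤ) - 1) * c₀') by ring]
  exact (dvd_add (Dvd.dvd.mul_left hy _) (Dvd.dvd.mul_right hxd _)).neg_right

/-- `β` vanishes on `A₀ ⊇ A⁺`. [folklore] -/
theorem betaF_eq_zero_of_mem_subA0 {x : Gamma0 (p * n)} (hx : x ∈ subA0 p n) : betaF p n x = 0 :=
  zmod_eq_zero_of_dvd hx

/-- `λ` vanishes on `B = Γ₀(p²n)`. [folklore] -/
theorem lamF_eq_zero_of_mem_subB [NeZero p] [NeZero n] {x : Gamma0 (p * n)} (hx : x ∈ subB p n) : lamF p n x = 0 := by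
  have hpn : ((p * n : ℕ) : ℤ) ≠ 0 := by exact_mod_cast (NeZero.ne (p * n))
  obtain ⟨k, hk⟩ := (mem_subB p n).mp hx
  unfold lamF
  rw [hk, show (((p * (p * n) : ℕ) : ℤ) * k) = ((p * n : ℕ) : ℤ) * (p * k) by push_cast; ring,
    Int.mul_ediv_cancel_left _ hpn]
  exact zmod_eq_zero_of_dvd ⟨k, rfl⟩

/-- `β(T) = 1`. [folklore] -/
theorem betaF_T : betaF p n (Tpow (p * n) 1) = 1 := by simp [betaF, Tpow, g0Of, slOf]

/-- `λ(Q₁) = −1`. [folklore] -/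
theorem lamF_Q1 [NeZero p] [NeZero n] : lamF p n (Q1 p n) = -1 := by
  have hpn : ((p * n : ℕ) : ℤ) ≠ 0 := by exact_mod_cast (NeZero.ne (p * n))
  unfold lamF
  rw [show (((Q1 p n : Gamma0 (p * n)) : SL(2, ℤ)) 1 0 : ℤ) = ((p * n : ℕ) : ℤ) * (-1) by simp [Q1, g0Of, slOf],
    Int.mul_ediv_cancel_left _ hpn]
  push_cast
  ring

/-- `T ∈ G₁`, `Q₁ ∈ G₁`. [folklore] -/
theorem Tpow_mem_subG1 (k : ℤ) : Tpow (p * n) k ∈ subG1 p n := by simp [mem_subG1, Tpow, g0Of, slOf]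

/-- `λ(T^k) = 0`. [folklore] -/
theorem lamF_Tpow (k : ℤ) : lamF p n (Tpow (p * n) k) = 0 := by simp [lamF, Tpow, g0Of, slOf]

end GOne

/-! ### §2. Heisenberg functions: value at `1`, inverses, `p`-th powers -/

section Heis

variable {G : Type*} [Group G] {p : ℕ}

/-- bookkeeping for a Heisenberg function `μ(xy) = μx + μy + βx·λy` with additive `β`, `λ`: `μ(1) = 0`, and
`2·μ(x^k) = 2k·μ(x) + k(k−1)·β(x)λ(x)`. [folklore] -/
theorem heis_pow {μ β lam : G → ZMod p} (hμ : ∀ x y, μ (x * y) = μ x + μ y + β x * lam y)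
    (hβ : ∀ x y, β (x * y) = β x + β y) (x : G) (k : ℕ) :
    2 * μ (x ^ k) = 2 * k * μ x + k * (k - 1) * (β x * lam x) := by
  have hβ1 : β 1 = 0 := by have := hβ 1 1; rw [mul_one] at this; linear_combination -this
  have hμ1 : μ 1 = 0 := by have := hμ 1 1; rw [mul_one, hβ1, zero_mul, add_zero] at this; linear_combination -this
  have hβpow : ∀ m : ℕ, β (x ^ m) = m * β x := by
    intro m
    induction m with
    | zero => rw [pow_zero, hβ1, Nat.cast_zero, zero_mul]
    | succ m ih => rw [pow_succ, hβ, ih, Nat.cast_succ]; ring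
  induction k with
  | zero => rw [pow_zero, hμ1]; simp
  | succ k ih =>
      rw [pow_succ, hμ, hβpow, mul_add, mul_add, ih, Nat.cast_succ]
      ring

/-- In `ℤ/p`, `p` an odd prime, a Heisenberg function kills `p`-th powers. [folklore] -/
theorem heis_pow_p_eq_zero [hp : Fact p.Prime] (hp2 : p ≠ 2) {μ β lam : G → ZMod p}
    (hμ : ∀ x y, μ (x * y) = μ x + μ y + β x * lam y) (hβ : ∀ x y, β (x * y) = β x + β y) (x : G) :
    μ (x ^ p) = 0 := by
  have h := heis_pow hμ hβ x p
  simp only [ZMod.natCast_self, mul_zero, zero_mul, add_zero] at h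
  have h2 : (2 : ZMod p) ≠ 0 := ShiftDescentModP.two_ne_zero_of_odd_prime hp2
  rcases mul_eq_zero.mp h with h0 | h0
  · exact absurd h0 h2
  · exact h0

end Heis

end PrimeShift

end Summit.BirchSwinnertonDyer.BirchSwinnertonDyer.Theorems.ManinLocalTwoThree

end
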